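import Mathlib.Analysis.InnerProductSpace.PiL2
import Summits.AtomisticToContinuum.Crystallization.Theorems.HullExactificationCascadeZeroDefectDensityAsmFrame
import HarnessLib

/-!
# Coordinates for the birth line of `ZeroDefectDensity` — I: the Gram–Schmidt frame of a soft shell
# (route `HullExactificationCascade`, crux `ZeroDefectDensity`, stmt-AtomisticToContinuum-12086; stub `stub_coordsHcp`)

Support file (lead c4, stub-worker) for the registered stub `stub_coordsHcp` of the birth skeleton:
twelve shell points labelled by the hcp kissing pattern, with norms `1 ± 1/4000`, contacts
`1 ± 1/4000`, square diagonals `|d² - 2| ≤ 38/4000`, `√3`-pairs `|d² - 3| ≤ 40/4000` and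
`√(8/3)`-pairs `|d² - 8/3| ≤ 60/4000`, are carried by a linear isometry to within `49/1000` of the
pattern.  This file is PATTERN-FREE numerics at tolerance `η = 1/4000`:

* `hcp_abs_sq_sub_one_le`, `hcp_inner_approx` — squared norms and inner products from the metric data;
* `hcp_sqrt_two_facts`, `hcp_inv_sub_inv_sqrt_two` — the interval lemma for `‖v‖⁻¹ ≈ (√2)⁻¹`;
* `hcp_frame_bounds` — for four shell vectors `pa, pb` (a square diagonal) and `pc, pd` (a square
  diagonal, all four of `(pa∣pb, pc∣pd)` contacts) the explicit Gram–Schmidt frame of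
  `v₁ = pa + pb`, `v₂ = pa - pb`, `v₃ = pc - pd` (toolkit `…ZeroDefectDensityAsmFrame`) is
  non-degenerate with `‖v₁‖, ‖w₂‖, ‖w₃‖ ≥ 1.41`, `|‖·‖⁻¹ - (√2)⁻¹| ≤ 0.00205` and skew terms
  `|⟪v₂,b₁⟫| ≤ 0.00071`, `|⟪v₃,b₁⟫|, |⟪v₃,b₂⟫| ≤ 0.00213`;
* `hcp_approx_coord`, `hcp_frame_coords` — the three frame coordinates of a shell vector whose four inner
  products with `pa, pb, pc, pd` are known to within `ea, eb, ec, ed`;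
* `coordsHcp_inv_norm` — registered one-line form of `hcp_inv_sub_inv_sqrt_two`.

All constants were checked in exact rational arithmetic; everything here is elementary. [folklore]
-/

noncomputable section

namespace Summit.AtomisticToContinuum.Crystallization.Theorems.ZeroDefectDensityBirth

open Real RealInnerProductSpace

/-! ### Interval lemmas -/

/-- Rational brackets for `√2` (eight decimals) and its square. [folklore] -/
theorem hcp_sqrt_two_facts : (1.41421356 : ℝ) < √2 ∧ √2 < 1.41421357 ∧ (√2) ^ 2 = 2 := by
  refine ⟨?_, ?_, Real.sq_sqrt (by norm_num)⟩
  · rw [Real.lt_sqrt (by norm_num)]; norm_num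
  · rw [Real.sqrt_lt' (by norm_num)]; norm_num

/-- `√18 = 3 √2`. [folklore] -/
theorem hcp_sqrt_eighteen : Real.sqrt 18 = 3 * √2 := by
  rw [show (18 : ℝ) = 3 ^ 2 * 2 by norm_num, Real.sqrt_mul (by norm_num), Real.sqrt_sq (by norm_num)]

/-- The inverse of a norm close to `√2`: if `n ≥ 1.41` and `|n² - 2| ≤ 0.011501` then
`|n⁻¹ - (√2)⁻¹| ≤ 0.00205`. [folklore] -/
theorem hcp_inv_sub_inv_sqrt_two {n : ℝ} (hL : 1.41 ≤ n) (h : |n ^ 2 - 2| ≤ 0.011501) :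
    |n⁻¹ - (√2)⁻¹| ≤ 0.00205 := by
  obtain ⟨hs1, -, hsq⟩ := hcp_sqrt_two_facts
  have hs0 : (0 : ℝ) < √2 := by linarith
  have hn0 : (0 : ℝ) < n := by linarith
  have h1 : |√2 - n| * (√2 + n) = |n ^ 2 - 2| := by
    rw [← abs_of_pos (show 0 < √2 + n by positivity), ← abs_mul, abs_sub_comm (n ^ 2) 2]
    congr 1
    linear_combination hsq
  have h2 : |√2 - n| ≤ 0.011501 / (1.41421356 + 1.41) := by
    rw [le_div_iff₀ (by norm_num)]
    calc |√2 - n| * (1.41421356 + 1.41) ≤ |√2 - n| * (√2 + n) := by gcongr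
      _ = |n ^ 2 - 2| := h1
      _ ≤ 0.011501 := h
  rw [inv_sub_inv hn0.ne' hs0.ne', abs_div, abs_of_pos (by positivity : (0 : ℝ) < n * √2),
    div_le_iff₀ (by positivity)]
  calc |√2 - n| ≤ 0.011501 / (1.41421356 + 1.41) := h2
    _ ≤ 0.00205 * (1.41 * 1.41421356) := by norm_num
    _ ≤ 0.00205 * (n * √2) := by gcongr

/-- Re-targeting an approximation: change the centre by an equality and enlarge the radius.
[folklore] -/
theorem hcp_retarget {x a b e e' : ℝ} (h : |x - a| ≤ e) (hab : a = b) (he : e ≤ e') :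
    |x - b| ≤ e' := (hab ▸ h).trans he

/-- Products of approximately known quantities, the first factor being an inverse norm close to
`(√2)⁻¹`: `|r s - K/√2| ≤ e/1.41 + |K|·0.00205`. [folklore] -/
theorem hcp_approx_coord {r s K e : ℝ} (hr0 : 0 ≤ r) (hr : r ≤ 1 / 1.41) (hι : |r - (√2)⁻¹| ≤ 0.00205)
    (hs : |s - K| ≤ e) : |r * s - K * (√2)⁻¹| ≤ e / 1.41 + |K| * 0.00205 := by
  have key : r * s - K * (√2)⁻¹ = r * (s - K) + K * (r - (√2)⁻¹) := by ring
  rw [key]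
  calc |r * (s - K) + K * (r - (√2)⁻¹)| ≤ |r * (s - K)| + |K * (r - (√2)⁻¹)| := abs_add_le _ _
    _ = r * |s - K| + |K| * |r - (√2)⁻¹| := by rw [abs_mul, abs_mul, abs_of_nonneg hr0]
    _ ≤ (1 / 1.41) * e + |K| * 0.00205 := by gcongr
    _ = e / 1.41 + |K| * 0.00205 := by ring

/-- Squares of lengths in `[1 - 1/4000, 1 + 1/4000]`. [folklore] -/
theorem hcp_abs_sq_sub_one_le {d : ℝ} (h : 1 - 1 / 4000 ≤ d ∧ d ≤ 1 + 1 / 4000) :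
    |d ^ 2 - 1| ≤ 0.0005001 := by
  rw [abs_le]
  constructor <;> nlinarith [h.1, h.2]

/-- Length of the first residual: pure arithmetic. [folklore] -/
theorem hcp_resid_sq_bound {y t : ℝ} (hy : |y - 2| ≤ 38 / 4000) (ht : |t| ≤ 0.00071) :
    |y - t ^ 2 - 2| ≤ 0.0095006 := by
  have h2 : t ^ 2 ≤ 0.00071 ^ 2 := by
    have := pow_le_pow_left₀ (abs_nonneg _) ht 2
    rwa [sq_abs] at this
  rw [abs_le] at hy ⊢
  constructor <;> nlinarith [sq_nonneg t]

/-- Length of the second residual: pure arithmetic. [folklore] -/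
theorem hcp_resid₂_sq_bound {y t t' : ℝ} (hy : |y - 2| ≤ 38 / 4000) (ht : |t| ≤ 0.00213)
    (ht' : |t'| ≤ 0.00213) : |y - t ^ 2 - t' ^ 2 - 2| ≤ 0.0095091 := by
  have h2 : t ^ 2 ≤ 0.00213 ^ 2 := by
    have := pow_le_pow_left₀ (abs_nonneg _) ht 2
    rwa [sq_abs] at this
  have h2' : t' ^ 2 ≤ 0.00213 ^ 2 := by
    have := pow_le_pow_left₀ (abs_nonneg _) ht' 2
    rwa [sq_abs] at this
  rw [abs_le] at hy ⊢
  constructor <;> nlinarith [sq_nonneg t, sq_nonneg t']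

section IP

variable {F : Type*} [NormedAddCommGroup F] [InnerProductSpace ℝ F]

/-- **Inner products from distances.** If `‖x‖², ‖y‖²` are within `0.0005001` of `1` and
`‖x - y‖²` is within `δ` of `N`, then `⟪x, y⟫` is within `0.0005001 + δ/2` of `(2 - N)/2`.
[folklore] -/
theorem hcp_inner_approx {x y : F} {N δ G e : ℝ} (hx : |‖x‖ ^ 2 - 1| ≤ 0.0005001)
    (hy : |‖y‖ ^ 2 - 1| ≤ 0.0005001) (hd : |‖x - y‖ ^ 2 - N| ≤ δ) (hG : G = (2 - N) / 2)
    (he : 0.0005001 + δ / 2 ≤ e) : |⟪x, y⟫ - G| ≤ e := by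
  have key : ⟪x, y⟫ - G = ((‖x‖ ^ 2 - 1) + (‖y‖ ^ 2 - 1) - (‖x - y‖ ^ 2 - N)) / 2 := by
    rw [hG, @norm_sub_sq_real]; ring
  rw [key]
  rw [abs_le] at hx hy hd ⊢
  constructor <;> linarith [hx.1, hx.2, hy.1, hy.2, hd.1, hd.2]

/-- **The frame of a soft shell.**  For shell vectors `pa, pb, pc, pd` of norms `1 ± 1/4000` with
`(pa,pb)` and `(pc,pd)` square diagonals (`|d² - 2| ≤ 38/4000`) and the four pairs `(pc∣pd, pa∣pb)`
contacts (`1 ± 1/4000`), the explicit Gram–Schmidt frame of `v₁ = pa + pb`, `v₂ = pa - pb`,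
`v₃ = pc - pd` is non-degenerate, with the listed bounds on the lengths and skew terms. [folklore] -/
theorem hcp_frame_bounds {pa pb pc pd v₁ v₂ v₃ b₁ b₂ : F}
    (hna : 1 - 1 / 4000 ≤ ‖pa‖ ∧ ‖pa‖ ≤ 1 + 1 / 4000) (hnb : 1 - 1 / 4000 ≤ ‖pb‖ ∧ ‖pb‖ ≤ 1 + 1 / 4000)
    (hnc : 1 - 1 / 4000 ≤ ‖pc‖ ∧ ‖pc‖ ≤ 1 + 1 / 4000) (hnd : 1 - 1 / 4000 ≤ ‖pd‖ ∧ ‖pd‖ ≤ 1 + 1 / 4000)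
    (hab : |‖pa - pb‖ ^ 2 - 2| ≤ 38 / 4000) (hcd : |‖pc - pd‖ ^ 2 - 2| ≤ 38 / 4000)
    (hca : 1 - 1 / 4000 ≤ ‖pc - pa‖ ∧ ‖pc - pa‖ ≤ 1 + 1 / 4000)
    (hcb : 1 - 1 / 4000 ≤ ‖pc - pb‖ ∧ ‖pc - pb‖ ≤ 1 + 1 / 4000)
    (hda : 1 - 1 / 4000 ≤ ‖pd - pa‖ ∧ ‖pd - pa‖ ≤ 1 + 1 / 4000)
    (hdb : 1 - 1 / 4000 ≤ ‖pd - pb‖ ∧ ‖pd - pb‖ ≤ 1 + 1 / 4000)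
    (hv₁ : v₁ = pa + pb) (hv₂ : v₂ = pa - pb) (hv₃ : v₃ = pc - pd)
    (hb₁ : b₁ = ‖v₁‖⁻¹ • v₁) (hb₂ : b₂ = ‖v₂ - ⟪v₂, b₁⟫ • b₁‖⁻¹ • (v₂ - ⟪v₂, b₁⟫ • b₁)) :
    v₁ ≠ 0 ∧ v₂ - ⟪v₂, b₁⟫ • b₁ ≠ 0 ∧ v₃ - ⟪v₃, b₁⟫ • b₁ - ⟪v₃, b₂⟫ • b₂ ≠ 0 ∧
    (1.41 ≤ ‖v₁‖ ∧ |‖v₁‖⁻¹ - (√2)⁻¹| ≤ 0.00205) ∧ |⟪v₂, b₁⟫| ≤ 0.00071 ∧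
    (1.41 ≤ ‖v₂ - ⟪v₂, b₁⟫ • b₁‖ ∧ |‖v₂ - ⟪v₂, b₁⟫ • b₁‖⁻¹ - (√2)⁻¹| ≤ 0.00205) ∧
    |⟪v₃, b₁⟫| ≤ 0.00213 ∧ |⟪v₃, b₂⟫| ≤ 0.00213 ∧
    (1.41 ≤ ‖v₃ - ⟪v₃, b₁⟫ • b₁ - ⟪v₃, b₂⟫ • b₂‖ ∧
      |‖v₃ - ⟪v₃, b₁⟫ • b₁ - ⟪v₃, b₂⟫ • b₂‖⁻¹ - (√2)⁻¹| ≤ 0.00205) := by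
  -- squared norms and the six inner products
  have ea := hcp_abs_sq_sub_one_le hna
  have eb := hcp_abs_sq_sub_one_le hnb
  have ec := hcp_abs_sq_sub_one_le hnc
  have ed := hcp_abs_sq_sub_one_le hnd
  have gca : |⟪pc, pa⟫ - 1 / 2| ≤ 0.00075015 :=
    hcp_inner_approx ec ea (hcp_abs_sq_sub_one_le hca) (by norm_num) (by norm_num)
  have gcb : |⟪pc, pb⟫ - 1 / 2| ≤ 0.00075015 :=
    hcp_inner_approx ec eb (hcp_abs_sq_sub_one_le hcb) (by norm_num) (by norm_num)
  have gda : |⟪pd, pa⟫ - 1 / 2| ≤ 0.00075015 :=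
    hcp_inner_approx ed ea (hcp_abs_sq_sub_one_le hda) (by norm_num) (by norm_num)
  have gdb : |⟪pd, pb⟫ - 1 / 2| ≤ 0.00075015 :=
    hcp_inner_approx ed eb (hcp_abs_sq_sub_one_le hdb) (by norm_num) (by norm_num)
  have gab : |⟪pa, pb⟫ - 0| ≤ 0.0052501 := hcp_inner_approx ea eb hab (by norm_num) (by norm_num)
  -- the first axis
  have nv1 : ‖v₁‖ ^ 2 = ‖pa‖ ^ 2 + 2 * ⟪pa, pb⟫ + ‖pb‖ ^ 2 := by
    rw [hv₁]; exact @norm_add_sq_real _ _ _ _ _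
  have hv1sq : |‖v₁‖ ^ 2 - 2| ≤ 0.0115004 := by
    rw [nv1]
    rw [abs_le] at ea eb gab ⊢
    constructor <;> linarith [ea.1, ea.2, eb.1, eb.2, gab.1, gab.2]
  have hL1 : 1.41 ≤ ‖v₁‖ :=
    (sq_le_sq₀ (by norm_num) (norm_nonneg _)).1 (by linarith [(abs_le.1 hv1sq).1])
  have hv1pos : 0 < ‖v₁‖ := by linarith
  have hv1ne : v₁ ≠ 0 := norm_pos_iff.1 hv1pos
  have n1 : ‖b₁‖ = 1 := by
    rw [hb₁, norm_smul, norm_inv, norm_norm, inv_mul_cancel₀ (norm_ne_zero_iff.2 hv1ne)]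
  have hι1 : |‖v₁‖⁻¹ - (√2)⁻¹| ≤ 0.00205 := hcp_inv_sub_inv_sqrt_two hL1 (hv1sq.trans (by norm_num))
  -- the skew term `⟪v₂, b₁⟫`
  have i21 : ⟪v₂, v₁⟫ = ‖pa‖ ^ 2 - ‖pb‖ ^ 2 := by
    rw [hv₁, hv₂, inner_sub_left, inner_add_right, inner_add_right, real_inner_self_eq_norm_sq,
      real_inner_self_eq_norm_sq, real_inner_comm pa pb]
    ring
  have hκ : |⟪v₂, b₁⟫| ≤ 0.00071 := by
    rw [hb₁, inner_gs₁, i21, abs_div, abs_of_pos hv1pos, div_le_iff₀ hv1pos]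
    calc |‖pa‖ ^ 2 - ‖pb‖ ^ 2| ≤ 0.0010002 := by
          rw [abs_le] at ea eb ⊢; constructor <;> linarith [ea.1, ea.2, eb.1, eb.2]
      _ ≤ 0.00071 * 1.41 := by norm_num
      _ ≤ 0.00071 * ‖v₁‖ := by gcongr
  -- the second axis
  have nw2 : ‖v₂ - ⟪v₂, b₁⟫ • b₁‖ ^ 2 = ‖v₂‖ ^ 2 - ⟪v₂, b₁⟫ ^ 2 := norm_sq_residual n1
  have nv2 : ‖v₂‖ ^ 2 = ‖pa - pb‖ ^ 2 := by rw [hv₂]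
  have hw2sq : |‖v₂ - ⟪v₂, b₁⟫ • b₁‖ ^ 2 - 2| ≤ 0.0095006 := by
    rw [nw2, nv2]; exact hcp_resid_sq_bound hab hκ
  have hL2 : 1.41 ≤ ‖v₂ - ⟪v₂, b₁⟫ • b₁‖ :=
    (sq_le_sq₀ (by norm_num) (norm_nonneg _)).1 (by linarith [(abs_le.1 hw2sq).1])
  have hw2pos : 0 < ‖v₂ - ⟪v₂, b₁⟫ • b₁‖ := by linarith
  have hw2ne : v₂ - ⟪v₂, b₁⟫ • b₁ ≠ 0 := norm_pos_iff.1 hw2pos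
  have n2 : ‖b₂‖ = 1 := by
    rw [hb₂, norm_smul, norm_inv, norm_norm, inv_mul_cancel₀ (norm_ne_zero_iff.2 hw2ne)]
  have hι2 : |‖v₂ - ⟪v₂, b₁⟫ • b₁‖⁻¹ - (√2)⁻¹| ≤ 0.00205 :=
    hcp_inv_sub_inv_sqrt_two hL2 (hw2sq.trans (by norm_num))
  have o12 : ⟪b₁, b₂⟫ = 0 := by
    rw [hb₂, real_inner_smul_right, real_inner_comm (v₂ - ⟪v₂, b₁⟫ • b₁) b₁,
      inner_residual_eq_zero n1, mul_zero]
  -- the skew terms `⟪v₃, b₁⟫`, `⟪v₃, b₂⟫`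
  have i31 : ⟪v₃, v₁⟫ = ⟪pc, pa⟫ + ⟪pc, pb⟫ - ⟪pd, pa⟫ - ⟪pd, pb⟫ := by
    rw [hv₃, hv₁, inner_sub_left, inner_add_right, inner_add_right]; ring
  have i32 : ⟪v₃, v₂⟫ = ⟪pc, pa⟫ - ⟪pc, pb⟫ - ⟪pd, pa⟫ + ⟪pd, pb⟫ := by
    rw [hv₃, hv₂, inner_sub_left, inner_sub_right, inner_sub_right]; ring
  have a31 : |⟪v₃, v₁⟫| ≤ 0.0030006 := by
    rw [i31]; rw [abs_le] at gca gcb gda gdb ⊢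
    constructor <;> linarith [gca.1, gca.2, gcb.1, gcb.2, gda.1, gda.2, gdb.1, gdb.2]
  have a32 : |⟪v₃, v₂⟫| ≤ 0.0030006 := by
    rw [i32]; rw [abs_le] at gca gcb gda gdb ⊢
    constructor <;> linarith [gca.1, gca.2, gcb.1, gcb.2, gda.1, gda.2, gdb.1, gdb.2]
  have hμ1 : |⟪v₃, b₁⟫| ≤ 0.00213 := by
    rw [hb₁, inner_gs₁, abs_div, abs_of_pos hv1pos, div_le_iff₀ hv1pos]
    calc |⟪v₃, v₁⟫| ≤ 0.0030006 := a31
      _ ≤ 0.00213 * 1.41 := by norm_num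
      _ ≤ 0.00213 * ‖v₁‖ := by gcongr
  have hμ2 : |⟪v₃, b₂⟫| ≤ 0.00213 := by
    have key : ⟪v₃, b₂⟫ = (⟪v₃, v₂⟫ - ⟪v₂, b₁⟫ * ⟪v₃, b₁⟫) / ‖v₂ - ⟪v₂, b₁⟫ • b₁‖ := by
      rw [hb₂, inner_gs_residual]
    rw [key, abs_div, abs_of_pos hw2pos, div_le_iff₀ hw2pos]
    calc |⟪v₃, v₂⟫ - ⟪v₂, b₁⟫ * ⟪v₃, b₁⟫| ≤ |⟪v₃, v₂⟫| + |⟪v₂, b₁⟫ * ⟪v₃, b₁⟫| := abs_sub _ _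
      _ = |⟪v₃, v₂⟫| + |⟪v₂, b₁⟫| * |⟪v₃, b₁⟫| := by rw [abs_mul]
      _ ≤ 0.0030006 + 0.00071 * 0.00213 := by gcongr
      _ ≤ 0.00213 * 1.41 := by norm_num
      _ ≤ 0.00213 * ‖v₂ - ⟪v₂, b₁⟫ • b₁‖ := by gcongr
  -- the third axis
  have nw3 : ‖v₃ - ⟪v₃, b₁⟫ • b₁ - ⟪v₃, b₂⟫ • b₂‖ ^ 2 = ‖v₃‖ ^ 2 - ⟪v₃, b₁⟫ ^ 2 - ⟪v₃, b₂⟫ ^ 2 :=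
    norm_sq_residual₂ n1 n2 o12
  have nv3 : ‖v₃‖ ^ 2 = ‖pc - pd‖ ^ 2 := by rw [hv₃]
  have hw3sq : |‖v₃ - ⟪v₃, b₁⟫ • b₁ - ⟪v₃, b₂⟫ • b₂‖ ^ 2 - 2| ≤ 0.0095091 := by
    rw [nw3, nv3]; exact hcp_resid₂_sq_bound hcd hμ1 hμ2
  have hL3 : 1.41 ≤ ‖v₃ - ⟪v₃, b₁⟫ • b₁ - ⟪v₃, b₂⟫ • b₂‖ :=
    (sq_le_sq₀ (by norm_num) (norm_nonneg _)).1 (by linarith [(abs_le.1 hw3sq).1])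
  have hw3pos : 0 < ‖v₃ - ⟪v₃, b₁⟫ • b₁ - ⟪v₃, b₂⟫ • b₂‖ := by linarith
  have hw3ne : v₃ - ⟪v₃, b₁⟫ • b₁ - ⟪v₃, b₂⟫ • b₂ ≠ 0 := norm_pos_iff.1 hw3pos
  have hι3 : |‖v₃ - ⟪v₃, b₁⟫ • b₁ - ⟪v₃, b₂⟫ • b₂‖⁻¹ - (√2)⁻¹| ≤ 0.00205 :=
    hcp_inv_sub_inv_sqrt_two hL3 (hw3sq.trans (by norm_num))
  exact ⟨hv1ne, hw2ne, hw3ne, ⟨hL1, hι1⟩, hκ, ⟨hL2, hι2⟩, hμ1, hμ2, ⟨hL3, hι3⟩⟩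

/-- **Coordinates of a shell vector in the frame.**  If the inner products of `p` (`‖p‖ ≤ 1 + 1/4000`)
with `pa, pb, pc, pd` are within `ea, eb, ec, ed` of `A₀, B₀, C₀, D₀`, then its coordinates in the
Gram–Schmidt frame of `hcp_frame_bounds` are within explicit distances of `(A₀+B₀)/√2`, `(A₀-B₀)/√2`,
`(C₀-D₀)/√2`. [folklore] -/
theorem hcp_frame_coords {p pa pb pc pd v₁ v₂ v₃ b₁ b₂ b₃ : F} {A₀ B₀ C₀ D₀ ea eb ec ed : ℝ}
    (hp : ‖p‖ ≤ 1 + 1 / 4000)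
    (hv₁ : v₁ = pa + pb) (hv₂ : v₂ = pa - pb) (hv₃ : v₃ = pc - pd)
    (hb₁ : b₁ = ‖v₁‖⁻¹ • v₁) (hb₂ : b₂ = ‖v₂ - ⟪v₂, b₁⟫ • b₁‖⁻¹ • (v₂ - ⟪v₂, b₁⟫ • b₁))
    (hb₃ : b₃ = ‖v₃ - ⟪v₃, b₁⟫ • b₁ - ⟪v₃, b₂⟫ • b₂‖⁻¹ • (v₃ - ⟪v₃, b₁⟫ • b₁ - ⟪v₃, b₂⟫ • b₂))
    (n₁ : ‖b₁‖ = 1) (n₂ : ‖b₂‖ = 1)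
    (hL₁ : 1.41 ≤ ‖v₁‖) (hι₁ : |‖v₁‖⁻¹ - (√2)⁻¹| ≤ 0.00205) (hκ : |⟪v₂, b₁⟫| ≤ 0.00071)
    (hL₂ : 1.41 ≤ ‖v₂ - ⟪v₂, b₁⟫ • b₁‖) (hι₂ : |‖v₂ - ⟪v₂, b₁⟫ • b₁‖⁻¹ - (√2)⁻¹| ≤ 0.00205)
    (hμ₁ : |⟪v₃, b₁⟫| ≤ 0.00213) (hμ₂ : |⟪v₃, b₂⟫| ≤ 0.00213)
    (hL₃ : 1.41 ≤ ‖v₃ - ⟪v₃, b₁⟫ • b₁ - ⟪v₃, b₂⟫ • b₂‖)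
    (hι₃ : |‖v₃ - ⟪v₃, b₁⟫ • b₁ - ⟪v₃, b₂⟫ • b₂‖⁻¹ - (√2)⁻¹| ≤ 0.00205)
    (ha : |⟪p, pa⟫ - A₀| ≤ ea) (hb : |⟪p, pb⟫ - B₀| ≤ eb) (hc : |⟪p, pc⟫ - C₀| ≤ ec)
    (hd : |⟪p, pd⟫ - D₀| ≤ ed) :
    |⟪p, b₁⟫ - (A₀ + B₀) * (√2)⁻¹| ≤ (ea + eb) / 1.41 + |A₀ + B₀| * 0.00205 ∧
    |⟪p, b₂⟫ - (A₀ - B₀) * (√2)⁻¹| ≤ (ea + eb + 0.00072) / 1.41 + |A₀ - B₀| * 0.00205 ∧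
    |⟪p, b₃⟫ - (C₀ - D₀) * (√2)⁻¹| ≤ (ec + ed + 0.00427) / 1.41 + |C₀ - D₀| * 0.00205 := by
  have hinv : ∀ {n : ℝ}, 1.41 ≤ n → n⁻¹ ≤ 1 / 1.41 := fun {n} h => by
    rw [one_div]; exact inv_anti₀ (by norm_num) h
  have hpa : ∀ {b : F}, ‖b‖ = 1 → |⟪p, b⟫| ≤ 1 + 1 / 4000 := fun {b} hb1 =>
    (abs_real_inner_le_norm _ _).trans (by rw [hb1, mul_one]; exact hp)
  -- first coordinate
  have hx : ⟪p, b₁⟫ = ‖v₁‖⁻¹ * (⟪p, pa⟫ + ⟪p, pb⟫) := by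
    rw [hb₁, inner_gs₁, hv₁, inner_add_right, div_eq_inv_mul]
  have sx : |⟪p, pa⟫ + ⟪p, pb⟫ - (A₀ + B₀)| ≤ ea + eb := by
    calc |⟪p, pa⟫ + ⟪p, pb⟫ - (A₀ + B₀)| = |(⟪p, pa⟫ - A₀) + (⟪p, pb⟫ - B₀)| := by ring_nf
      _ ≤ |⟪p, pa⟫ - A₀| + |⟪p, pb⟫ - B₀| := abs_add_le _ _
      _ ≤ ea + eb := add_le_add ha hb
  have cx : |⟪p, b₁⟫ - (A₀ + B₀) * (√2)⁻¹| ≤ (ea + eb) / 1.41 + |A₀ + B₀| * 0.00205 := by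
    rw [hx]; exact hcp_approx_coord (inv_nonneg.2 (norm_nonneg _)) (hinv hL₁) hι₁ sx
  -- second coordinate
  have hpv2 : ⟪p, v₂⟫ = ⟪p, pa⟫ - ⟪p, pb⟫ := by rw [hv₂, inner_sub_right]
  have hy : ⟪p, b₂⟫ = ‖v₂ - ⟪v₂, b₁⟫ • b₁‖⁻¹ * (⟪p, pa⟫ - ⟪p, pb⟫ - ⟪v₂, b₁⟫ * ⟪p, b₁⟫) := by
    rw [hb₂, inner_gs_residual, hpv2, div_eq_inv_mul]
  have sy : |⟪p, pa⟫ - ⟪p, pb⟫ - ⟪v₂, b₁⟫ * ⟪p, b₁⟫ - (A₀ - B₀)| ≤ ea + eb + 0.00072 := by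
    have h21 : |⟪v₂, b₁⟫ * ⟪p, b₁⟫| ≤ 0.00071 * (1 + 1 / 4000) := by
      rw [abs_mul]; exact mul_le_mul hκ (hpa n₁) (abs_nonneg _) (by norm_num)
    calc |⟪p, pa⟫ - ⟪p, pb⟫ - ⟪v₂, b₁⟫ * ⟪p, b₁⟫ - (A₀ - B₀)|
          = |(⟪p, pa⟫ - A₀) - (⟪p, pb⟫ - B₀) - ⟪v₂, b₁⟫ * ⟪p, b₁⟫| := by ring_nf
      _ ≤ |(⟪p, pa⟫ - A₀) - (⟪p, pb⟫ - B₀)| + |⟪v₂, b₁⟫ * ⟪p, b₁⟫| := abs_sub _ _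
      _ ≤ |⟪p, pa⟫ - A₀| + |⟪p, pb⟫ - B₀| + |⟪v₂, b₁⟫ * ⟪p, b₁⟫| := by
          gcongr; exact abs_sub _ _
      _ ≤ ea + eb + 0.00071 * (1 + 1 / 4000) := by gcongr
      _ ≤ ea + eb + 0.00072 := by linarith
  have cy : |⟪p, b₂⟫ - (A₀ - B₀) * (√2)⁻¹| ≤ (ea + eb + 0.00072) / 1.41 + |A₀ - B₀| * 0.00205 := by
    rw [hy]; exact hcp_approx_coord (inv_nonneg.2 (norm_nonneg _)) (hinv hL₂) hι₂ sy
  -- third coordinate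
  have hpv3 : ⟪p, v₃⟫ = ⟪p, pc⟫ - ⟪p, pd⟫ := by rw [hv₃, inner_sub_right]
  have hz : ⟪p, b₃⟫ = ‖v₃ - ⟪v₃, b₁⟫ • b₁ - ⟪v₃, b₂⟫ • b₂‖⁻¹ *
      (⟪p, pc⟫ - ⟪p, pd⟫ - ⟪v₃, b₁⟫ * ⟪p, b₁⟫ - ⟪v₃, b₂⟫ * ⟪p, b₂⟫) := by
    rw [hb₃, inner_gs_residual₂, hpv3, div_eq_inv_mul]
  have sz : |⟪p, pc⟫ - ⟪p, pd⟫ - ⟪v₃, b₁⟫ * ⟪p, b₁⟫ - ⟪v₃, b₂⟫ * ⟪p, b₂⟫ - (C₀ - D₀)| ≤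
      ec + ed + 0.00427 := by
    have h31 : |⟪v₃, b₁⟫ * ⟪p, b₁⟫| ≤ 0.00213 * (1 + 1 / 4000) := by
      rw [abs_mul]; exact mul_le_mul hμ₁ (hpa n₁) (abs_nonneg _) (by norm_num)
    have h32 : |⟪v₃, b₂⟫ * ⟪p, b₂⟫| ≤ 0.00213 * (1 + 1 / 4000) := by
      rw [abs_mul]; exact mul_le_mul hμ₂ (hpa n₂) (abs_nonneg _) (by norm_num)
    calc |⟪p, pc⟫ - ⟪p, pd⟫ - ⟪v₃, b₁⟫ * ⟪p, b₁⟫ - ⟪v₃, b₂⟫ * ⟪p, b₂⟫ - (C₀ - D₀)|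
          = |(⟪p, pc⟫ - C₀) - (⟪p, pd⟫ - D₀) - ⟪v₃, b₁⟫ * ⟪p, b₁⟫ - ⟪v₃, b₂⟫ * ⟪p, b₂⟫| := by
            ring_nf
      _ ≤ |(⟪p, pc⟫ - C₀) - (⟪p, pd⟫ - D₀) - ⟪v₃, b₁⟫ * ⟪p, b₁⟫| + |⟪v₃, b₂⟫ * ⟪p, b₂⟫| :=
            abs_sub _ _
      _ ≤ |(⟪p, pc⟫ - C₀) - (⟪p, pd⟫ - D₀)| + |⟪v₃, b₁⟫ * ⟪p, b₁⟫| + |⟪v₃, b₂⟫ * ⟪p, b₂⟫| := by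
            gcongr; exact abs_sub _ _
      _ ≤ |⟪p, pc⟫ - C₀| + |⟪p, pd⟫ - D₀| + |⟪v₃, b₁⟫ * ⟪p, b₁⟫| + |⟪v₃, b₂⟫ * ⟪p, b₂⟫| := by
            gcongr; exact abs_sub _ _
      _ ≤ ec + ed + 0.00213 * (1 + 1 / 4000) + 0.00213 * (1 + 1 / 4000) := by gcongr
      _ ≤ ec + ed + 0.00427 := by linarith
  have cz : |⟪p, b₃⟫ - (C₀ - D₀) * (√2)⁻¹| ≤ (ec + ed + 0.00427) / 1.41 + |C₀ - D₀| * 0.00205 := by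
    rw [hz]; exact hcp_approx_coord (inv_nonneg.2 (norm_nonneg _)) (hinv hL₃) hι₃ sz
  exact ⟨cx, cy, cz⟩

end IP

/-- **Registered sub-goal `coordsHcp_inv_norm`** (one-line form of `hcp_inv_sub_inv_sqrt_two`, lead c4
stub-worker). [folklore] -/
theorem coordsHcp_inv_norm : ∀ n : ℝ, 1.41 ≤ n → |n ^ 2 - 2| ≤ 0.011501 → |n⁻¹ - (Real.sqrt 2)⁻¹| ≤ 0.00205 :=
  fun _ h1 h2 => hcp_inv_sub_inv_sqrt_two h1 h2

end Summit.AtomisticToContinuum.Crystallization.Theorems.ZeroDefectDensityBirth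

end
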